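import Summits.ABC.StewartYu.PadicG3HalfRebase
import HarnessLib

/-!
# Cell abc-stewartyu, crux `Y07Odd` (stmt-ABC-19658), line `gen3-slab-odd`: algebra of the half-step on the level invariant — the surviving class
# `B″` of a pivot, and the PM sign on it is the new sign class `sgnOf w`

`Summits/ABC/StewartYu/PadicG3LevelStepHAlg.lean` — cell `abc-stewartyu` (design HOME/p2/HALFSTEP-ODD.md §LEVEL INVARIANT; seat p2-g4, F-odd lead).
Definition (`pivotClass`) and theorems on `G3Setup`; no named fact.  With the exponent-class data of `PadicG3ExpClassPM.exists_expClass_pm`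
(`kᵢ = 2qᵢ s + δᵢ s + a`, `(p−1)qᵢ + Mδᵢ = Σ_j r_j vᵢⱼ`, `δᵢ` the sign class) at an odd point `s`:

* `cls_eq_zeta_zpow` — `cls w = ζ^{Σ_j r_j w_j}` for `η_j = ζ^{r_j}`;
* `pivotClass v sgn B i₀ = {i ∈ B : vᵢ ≡ v_{i₀} (mod 2), sgnᵢ = sgn_{i₀}}`; `mem_pivotClass_iff_fibre` — it is exactly the fibre
  `{parity(kᵢ) = parity(k_{i₀}), SsetG(eᵢ) = SsetG(e_{i₀})}` of the PM class sums (`eᵢ = rootExp L vᵢ s`);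
* `cls_halfDiff_eq` — on it, `cls(wᵢ) = (−1)^{qᵢ − q_{i₀}}` for `wᵢ = halfDiff v i₀ i`, hence (`negOnePow_half_k`) the PM sign
  `(−1)^{⌊kᵢ/2⌋} = (−1)^{⌊k_{i₀}/2⌋} · sgnOf w i` — a GLOBAL sign times the new sign class.

WHAT THIS IS NOT: the half-step theorem itself (`PadicG3LevelStepH`); no crux moves.

References: K. Yu, Compositio 74 (1990) (2.101)–(2.106); cell memo HOME/p3/memo-05 §3.
-/

noncomputable section

open NormedSpace Finset Polynomial
open Literature.NumberTheory.Transcendental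
open scoped Nat

namespace Summit.ABC.StewartYu

namespace G3Setup

variable {p : ℕ} [Fact p.Prime] (S : G3Setup p) {ι : Type*}

/-- `cls w = ζ^{Σ_j r_j w_j}` when `η_j = ζ^{r_j}`, `ζ ≠ 0`. [folklore] -/
theorem cls_eq_zeta_zpow {ζ : ℚ_[p]} (hζ0 : ζ ≠ 0) (r : Fin S.n → ℕ) (hη : ∀ j, S.η j = ζ ^ r j) (w : Fin S.n → ℤ) :
    S.cls w = ζ ^ (∑ j, (r j : ℤ) * w j) := by
  have hzs : ∀ (t : Finset (Fin S.n)), ζ ^ (∑ j ∈ t, (r j : ℤ) * w j) = ∏ j ∈ t, ζ ^ ((r j : ℤ) * w j) := by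
    intro t
    induction t using Finset.induction_on with
    | empty => simp
    | insert j t hj ih => rw [sum_insert hj, prod_insert hj, zpow_add₀ hζ0, ih]
  unfold cls
  rw [hzs]
  refine prod_congr rfl fun j _ => ?_
  rw [hη j, ← zpow_natCast, ← zpow_mul]

/-- **The surviving class of the pivot `i₀`**: same parity pattern and same sign. [cite: Nesterenko2003, §4.3; shape only] -/
def pivotClass (v : ι → Fin S.n → ℤ) (sgn : ι → ℤ) (B : Finset ι) (i₀ : ι) : Finset ι :=
  B.filter fun i => (∀ j, 2 ∣ v i j - v i₀ j) ∧ sgn i = sgn i₀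

/-- Membership. [folklore] -/
theorem mem_pivotClass {v : ι → Fin S.n → ℤ} {sgn : ι → ℤ} {B : Finset ι} {i₀ i : ι} :
    i ∈ S.pivotClass v sgn B i₀ ↔ i ∈ B ∧ (∀ j, 2 ∣ v i j - v i₀ j) ∧ sgn i = sgn i₀ := by
  unfold pivotClass; rw [mem_filter]

/-- `pivotClass ⊆ B`, and the pivot lies in it. [folklore] -/
theorem pivotClass_subset (v : ι → Fin S.n → ℤ) (sgn : ι → ℤ) (B : Finset ι) (i₀ : ι) : S.pivotClass v sgn B i₀ ⊆ B :=
  filter_subset _ _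

/-- The pivot lies in its class. [folklore] -/
theorem self_mem_pivotClass {v : ι → Fin S.n → ℤ} {sgn : ι → ℤ} {B : Finset ι} {i₀ : ι} (h : i₀ ∈ B) :
    i₀ ∈ S.pivotClass v sgn B i₀ :=
  S.mem_pivotClass.mpr ⟨h, fun j => by simp, rfl⟩

/-- **Parity patterns**: at an odd `s`, `SsetG(rootExp L vᵢ s) = SsetG(rootExp L v_{i₀} s) ↔ ∀ j, 2 ∣ vᵢⱼ − v_{i₀ⱼ}`. [folklore] -/
theorem SsetG_eq_iff {L : Fin S.n → ℕ} {v : ι → Fin S.n → ℤ} {i i₀ : ι} (hi : ∀ j, |v i j| ≤ (L j : ℤ)) (hi₀ : ∀ j, |v i₀ j| ≤ (L j : ℤ))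
    {s : ℤ} (hs : Odd s) :
    HalfMono.SsetG (S.rootExp L (v i) s) = HalfMono.SsetG (S.rootExp L (v i₀) s) ↔ ∀ j, 2 ∣ v i j - v i₀ j := by
  rw [S.SsetG_rootExp_of_odd hi hs, S.SsetG_rootExp_of_odd hi₀ hs]
  constructor
  · intro h j
    have hj : (j ∈ univ.filter fun j => Odd (v i j)) ↔ (j ∈ univ.filter fun j => Odd (v i₀ j)) := by rw [h]
    simp only [mem_filter, mem_univ, true_and] at hj
    rcases Int.even_or_odd (v i j) with h1 | h1 <;> rcases Int.even_or_odd (v i₀ j) with h2 | h2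
    · exact (even_iff_two_dvd.mp (h1.sub h2))
    · exact absurd (hj.mpr h2) (Int.not_odd_iff_even.mpr h1)
    · exact absurd (hj.mp h1) (Int.not_odd_iff_even.mpr h2)
    · exact (even_iff_two_dvd.mp (h1.sub_odd h2))
  · intro h
    ext j
    simp only [mem_filter, mem_univ, true_and]
    obtain ⟨c, hc⟩ := h j
    have : v i j = v i₀ j + 2 * c := by linarith
    rw [this]
    constructor
    · intro ho
      by_contra he
      rw [Int.not_odd_iff_even] at he
      exact (Int.not_even_iff_odd.mpr ho) (he.add (even_two_mul c))
    · intro ho; exact ho.add_even (even_two_mul c)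

/-- **Parity of the class index is the sign class**: with `kᵢ = 2qᵢ s + δᵢ s + a` (`s` odd, `δ ∈ {0,1}`),
`Even kᵢ ↔ Even k_{i₀}` iff `δᵢ = δ_{i₀}`. [folklore] -/
theorem even_k_iff {k : ι → ℕ} {q : ι → ℤ} {δ : ι → ℤ} {a : ℕ} {s : ℤ} (hs : Odd s) {i i₀ : ι}
    (hki : (k i : ℤ) = 2 * (q i * s) + δ i * s + a) (hki₀ : (k i₀ : ℤ) = 2 * (q i₀ * s) + δ i₀ * s + a)
    (hδi : δ i = 0 ∨ δ i = 1) (hδi₀ : δ i₀ = 0 ∨ δ i₀ = 1) :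
    (Even (k i) ↔ Even (k i₀)) ↔ δ i = δ i₀ := by
  obtain ⟨u, hu⟩ := hs
  rw [Nat.even_iff, Nat.even_iff]
  rcases hδi with hd | hd <;> rcases hδi₀ with hd' | hd' <;> rw [hd] at hki <;> rw [hd'] at hki₀ <;> rw [hd, hd'] <;> omega

/-- **The new sign class is the PM sign up to a global sign.**  On the pivot class (same `δ`), with `(p−1)qᵢ + Mδᵢ = Σ_j r_j vᵢⱼ`:
`Σ_j r_j wᵢⱼ = M (qᵢ − q_{i₀})` for `wᵢ = halfDiff v i₀ i`, hence `cls(wᵢ) = (−1)^{qᵢ − q_{i₀}}`. [cite: Yu1990, (2.105); shape only] -/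
theorem cls_halfDiff_eq {ζ : ℚ_[p]} (hζ : IsPrimitiveRoot ζ (p - 1)) (hζM : ζ ^ ((p - 1) / 2) = -1) (r : Fin S.n → ℕ)
    (hη : ∀ j, S.η j = ζ ^ r j) {v : ι → Fin S.n → ℤ} {i i₀ : ι} (hpar : ∀ j, 2 ∣ v i j - v i₀ j)
    {q : ι → ℤ} {δ : ℤ} (hqi : ((p - 1 : ℕ) : ℤ) * q i + (((p - 1) / 2 : ℕ) : ℤ) * δ = ∑ j, (r j : ℤ) * v i j)
    (hqi₀ : ((p - 1 : ℕ) : ℤ) * q i₀ + (((p - 1) / 2 : ℕ) : ℤ) * δ = ∑ j, (r j : ℤ) * v i₀ j) :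
    S.cls (S.halfDiff v i₀ i) = (-1 : ℚ_[p]) ^ (q i - q i₀) := by
  have hζ0 : ζ ≠ 0 := hζ.ne_zero (by have := S.hp3; omega)
  have hev : Even (p - 1) := by
    have hp : p.Prime := Fact.out
    obtain ⟨m, hm⟩ := hp.odd_of_ne_two (by have := S.hp3; omega)
    exact ⟨m, by omega⟩
  have h2M : (((p - 1 : ℕ) : ℤ)) = 2 * (((p - 1) / 2 : ℕ) : ℤ) := by exact_mod_cast (Nat.two_mul_div_two_of_even hev).symm
  -- `2 Σ r w = Σ r (vᵢ − v_{i₀}) = (p−1)(qᵢ − q_{i₀})`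
  have hsum : 2 * ∑ j, (r j : ℤ) * S.halfDiff v i₀ i j = ((p - 1 : ℕ) : ℤ) * (q i - q i₀) := by
    have hw : ∀ j, 2 * S.halfDiff v i₀ i j = v i j - v i₀ j := fun j => by
      simp only [halfDiff]; exact Int.mul_ediv_cancel' (hpar j)
    calc 2 * ∑ j, (r j : ℤ) * S.halfDiff v i₀ i j = ∑ j, (r j : ℤ) * (2 * S.halfDiff v i₀ i j) := by
          rw [mul_sum]; exact sum_congr rfl fun j _ => by ring
      _ = ∑ j, (r j : ℤ) * (v i j - v i₀ j) := sum_congr rfl fun j _ => by rw [hw j]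
      _ = ∑ j, (r j : ℤ) * v i j - ∑ j, (r j : ℤ) * v i₀ j := by rw [← sum_sub_distrib]; exact sum_congr rfl fun j _ => by ring
      _ = ((p - 1 : ℕ) : ℤ) * (q i - q i₀) := by rw [← hqi, ← hqi₀]; ring
  have hsum' : ∑ j, (r j : ℤ) * S.halfDiff v i₀ i j = (((p - 1) / 2 : ℕ) : ℤ) * (q i - q i₀) := by
    rw [h2M] at hsum; linarith
  rw [S.cls_eq_zeta_zpow hζ0 r hη, hsum', zpow_mul, zpow_natCast, hζM]

/-- **The PM sign on the pivot class**: `(−1)^{⌊kᵢ/2⌋} = (−1)^{⌊k_{i₀}/2⌋}·cls(wᵢ)` (in `ℚ_p`; `kᵢ = 2qᵢ s + δ s + a` with the SAME `δ`, `s` odd).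
[cite: Yu1990, (2.104)–(2.106); shape only] -/
theorem negOnePow_half_k {k : ι → ℕ} {q : ι → ℤ} {δ : ℤ} {a : ℕ} {s : ℤ} (hs : Odd s) {i i₀ : ι}
    (hki : (k i : ℤ) = 2 * (q i * s) + δ * s + a) (hki₀ : (k i₀ : ℤ) = 2 * (q i₀ * s) + δ * s + a) :
    ((-1 : ℚ_[p])) ^ (k i / 2) = (-1 : ℚ_[p]) ^ (k i₀ / 2) * (-1 : ℚ_[p]) ^ (q i - q i₀) := by
  obtain ⟨u, hu⟩ := hs
  -- parities: `k i / 2 ≡ k i₀ / 2 + (q i − q i₀) (mod 2)`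
  have hdiv : ((k i / 2 : ℕ) : ℤ) = (k i : ℤ) / 2 := by omega
  have hdiv₀ : ((k i₀ / 2 : ℕ) : ℤ) = (k i₀ : ℤ) / 2 := by omega
  rw [neg_one_pow_eq_pow_mod_two (R := ℚ_[p]) (n := k i / 2), neg_one_pow_eq_pow_mod_two (R := ℚ_[p]) (n := k i₀ / 2)]
  rcases Int.even_or_odd (q i - q i₀) with hev | hodd
  · rw [hev.neg_one_zpow, mul_one]
    obtain ⟨c, hc⟩ := hev
    have hcs : q i * s - q i₀ * s = 2 * (c * s) := by rw [← sub_mul, hc]; ring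
    have hpar : (k i / 2) % 2 = (k i₀ / 2) % 2 := by
      have h1 : ((k i / 2 : ℕ) : ℤ) % 2 = ((k i₀ / 2 : ℕ) : ℤ) % 2 := by
        rw [hdiv, hdiv₀, hki, hki₀]; omega
      omega
    rw [hpar]
  · rw [hodd.neg_one_zpow, mul_neg, mul_one]
    obtain ⟨c, hc⟩ := hodd
    have hcs : q i * s - q i₀ * s = 2 * (c * s) + s := by rw [← sub_mul, hc]; ring
    have hpar : (k i / 2) % 2 = ((k i₀ / 2) + 1) % 2 := by
      have h1 : ((k i / 2 : ℕ) : ℤ) % 2 = (((k i₀ / 2 : ℕ) : ℤ) + 1) % 2 := by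
        rw [hdiv, hdiv₀, hki, hki₀]; omega
      omega
    rw [hpar]
    rcases Nat.mod_two_eq_zero_or_one (k i₀ / 2) with h0 | h0
    · rw [h0, show (k i₀ / 2 + 1) % 2 = 1 by omega]; norm_num
    · rw [h0, show (k i₀ / 2 + 1) % 2 = 0 by omega]; norm_num

end G3Setup

end Summit.ABC.StewartYu

end
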